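import Summits.QuantumFields.YangMills.Theorems.FluctuationComparisonRegPrIntLWregChartChargeOneStep
import Summits.QuantumFields.YangMills.Theorems.BalabanUVNodesN09CentralWindowAtRecord
import Summits.QuantumFields.YangMills.Theorems.BalabanUVNodesN09ChartReadAveragingSmooth
import Literature.MathematicalPhysics.QuantumFieldTheory.Balaban1983to89.T3UnitScaleTilt
import Literature.MathematicalPhysics.QuantumFieldTheory.Balaban1983to89.T3UnitLawDensityEML
import Literature.MathematicalPhysics.QuantumFieldTheory.Balaban1983to89.T4TriangularPushforward
import Literature.MathematicalPhysics.QuantumFieldTheory.Balaban1983to89.LatticeWordStokes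
import Literature.MathematicalPhysics.QuantumFieldTheory.Balaban1983to89.B12ContinuousTransportInvariance
import HarnessLib

/-!
# `FluctuationComparisonRegPrIntLWregChartCharge` — CHARGE: PARAMETRIC SOLVABILITY OF `Ū⁽ᴷ⁻ᴶ⁾(extend β g z) = W` NEAR AN INTERIOR SMALL-FIELD SOLUTION
# (File 3 of 3: the Theorems-side twin of the stub `stub_chartCharge : ChartCharge` of LINE g18-2 `Cruxes/FluctuationComparisonRegPrIntL/Lines/wreg_chart.lean`,
# organ WREG `WindowRegularity` of the DECIDING crux `FluctuationComparisonRegPrIntL` = stmt-QuantumFields-20520)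

Cell `ym3-torus` (HUMAN RULING D-0037: YM₃ on T³ is ladder rung R3 — NOT d = 4, NOT infinite volume, NOT a mass gap, NOT the Clay problem); width seat
`ym-ust-20520-w3` gen 13; `--supports stmt-QuantumFields-20520 --as helper` (count-neutral).  THEOREMS ONLY (0 `def`, 0 `sorry`, default heartbeats).
LINE OWNER word: ideator ym-r3-idea-1 g18 «CHARGE → w3-20520 g13: GO; the β-abstraction of the Cruxes-local `iterCentralBond` is sound; door-fit
`exact chartCharge_holds (fun P n => iterCentralBond n) (fun _ _ => rfl) (fun _ _ _ => rfl)`» (ym3-torus STATUS 2026-08-29T14:51:43Z); ★★OWNER ym3-torus-plan g31 WORD 26 (B).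

THE STATEMENT.  `ChartCharge` (`wreg_chart.lean` v15 :2327) VERBATIM, except that the Cruxes-local RECURSIVE definition `iterCentralBond (K − J)` (v15 :621:
`| 0 => id | n+1 => iterCentralBond n ∘ centralBond`), which no `Theorems/` file can import, is ABSTRACTED by its recursion: leading binders
`(β : ∀ P n, PBond P n → PBond P 0) (hβ0 : ∀ P c, β P 0 c = c) (hβs : ∀ P n c, β P (n+1) c = β P n (centralBond c))`, then the stub text with `iterCentralBond (K - J)` ↦
`β (F.P K) (K - J)` (string-checked 872∕872 chars).  For every block size, every `K, J`, every smallness profile `θ ≥ 0` with `(((d+2)L)²∕4)·θᵢ ≤ α` in the chart regime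
(`0 < α ≤ 1∕24`, `64α ≤ δ_SU(2)`, `157α < L^{−(d−1)}`, offCard gap), and every level-`(K−J)` datum `W`: if some `U₀` in the INTERIOR of the UV-small-history event
`histGood F ℰp θ K J` has `Ū⁽ᴷ⁻ᴶ⁾ U₀ = W`, then `fieldMeasure {z | ∃ g, extend β g z ∈ histGood ∧ Ū⁽ᴷ⁻ᴶ⁾(extend β g z) = W} > 0`.

THE PROOF (parametric solvability; no degree theory, no `Classical.choice` chart, no Bałaban estimate asserted):
* §6 β-letters (adapted from `wreg_chart.lean` §0, credited): `β_injective`, ★`isLocal_iter` (the `n`-fold averaging is TRIANGULAR in the pivots `βₙ`, every group, every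
  small-loop average — ✓`isLocal_avgFun` level by level), ★`iter_update_succ_apply` (the chain recursion), `iter_extend_apply` (each output `c` of `Ū⁽ⁿ⁾(extend βₙ g z)` reads
  only its own pivot — ✓`T4TriangularPushforward.apply_eq_of_agree`), `extend_comp_self`.
* §7 `continuousAt_iter_of_loopSmall` (✓`continuousAt_avgFun_of_small` iterated) and ★★`map_nhds_iterPivot_eq`: for `n ≤ m+K` and `U₀` whose intermediate averages have loop
  variables `≤ α`, `map (z,g) ↦ (z, Ū⁽ⁿ⁾(z[βₙ c ↦ g])(c)) (𝓝 (U₀, U₀(βₙ c))) = 𝓝 (U₀, Ū⁽ⁿ⁾ U₀ c)` — induction on `n`: the step is File 2's ★★★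
  `map_nhds_oneVariable₂_eq_of_mem_centralWindow` (the one-bond (0.4) average is jointly open in (environment, pivot) at the environment `Ū⁽ⁿ⁾U₀`'s own central value,
  ✓`self_mem_centralWindow_iff`) pulled back along the continuous `Ū⁽ⁿ⁾` (File 1's `map_nhds_param_pullback`) and composed with the induction hypothesis at `centralBond c`;
  ★★`map_nhds_iterExtend_eq`: all pivots at once (File 1's `map_nhds_param_pi`).
* §8 ★★`chartCharge_holds`: at the interior point every intermediate average is `θ`-small so ✓`LatticeWordStokes.dist1_loopHol_le` puts its loop variables in the `α`-guard;
  the preimage of `interior histGood` under the continuous shuffle `(z,g) ↦ extend β g z` is a neighbourhood of `(U₀, U₀ ∘ β)`, its image under the §7 map is a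
  neighbourhood of `(U₀, W)`, the slice at `W` is a neighbourhood of `U₀` inside the target set, and product Haar on `SU(2)`-fields charges neighbourhoods
  (✓`B12ContinuousTransportInvariance.isOpenPosMeasure_fieldMeasure_SU`).

HONEST FRAMING.  A qualitative regularity fact about Bałaban's printed one-step averaging on a FIXED finite lattice, by name over the pub-ymgap N07∕N09 chart calculus;
CHARGE is ONE of the four chart-free inputs (VOL ✓p726709 ∕ in-file, EDGE, LEVEL-NEAR, CHARGE) of the PROVED assembly `windowChartsExist_of_flat` of the line; WREG, S2β,
the crux `FluctuationComparisonRegPrIntL` (stmt-QuantumFields-20520) and every summit statement are NOT proved here; YM₃ on T³ = rung R3 — NOT d = 4, NOT infinite volume,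
NOT a mass gap, NOT Clay; the Yang–Mills mass gap is NOT proved.

References: T. Bałaban, CMP 109 (1987) 249–301 [Balaban1987RG1] ((0.4) p.253, (2.9)–(2.10) pp.266–267); CMP 98 (1985) 17–51 [Balaban1985Averaging] ((10) p.19, Prop. 3 (124)
p.36); CMP 102 (1985) 255–275 [Balaban1985UV3] ((7) p.257).
-/

noncomputable section

open MeasureTheory Filter Topology Set Function
open Literature.MathematicalPhysics.QuantumFieldTheory.Balaban1983to89
open Literature.MathematicalPhysics.QuantumFieldTheory.Balaban1983to89.T3ContinuumYM3Torus
open Literature.MathematicalPhysics.QuantumFieldTheory.Balaban1983to89.T3UnitLawDensityEML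
open Literature.MathematicalPhysics.QuantumFieldTheory.Balaban1983to89.T3UnitScaleTilt
open Literature.MathematicalPhysics.QuantumFieldTheory.Balaban1983to89.ExpMeanLog (expMeanLogSU deltaSU)
open Literature.MathematicalPhysics.QuantumFieldTheory.Balaban1983to89.BlockAveraging (Idx avgFun loopHol Small)
open Literature.MathematicalPhysics.QuantumFieldTheory.Balaban1983to89.BlockAveragingHaarAC (centralBond centralBond_injective isLocal_avgFun pre post)
open Literature.MathematicalPhysics.QuantumFieldTheory.Balaban1983to89.BlockAveragingEMLHaarAC (offCard fibreFamily)
open Literature.MathematicalPhysics.QuantumFieldTheory.Balaban1983to89.T4TriangularPushforward (IsLocal)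
open Literature.MathematicalPhysics.QuantumFieldTheory.Balaban1983to89.Node00 (SU)
open Literature.MathematicalPhysics.QuantumFieldTheory.Balaban1983to89.LatticeWordStokes (dist1_loopHol_le)
open Summit.QuantumFields.YangMills.BalabanUVNodes.N09CentralWindowAtRecord (self_mem_centralWindow_iff)
open Summit.QuantumFields.YangMills.BalabanUVNodes.N09ChartReadAveragingSmooth (continuousAt_avgFun_of_small)
open Summit.QuantumFields.YangMills.Theorems.FluctuationComparisonRegPrIntLWregChartChargeParam (map_nhds_param_pullback map_nhds_param_pi)
open Summit.QuantumFields.YangMills.Theorems.FluctuationComparisonRegPrIntLWregChartChargeOneStep (map_nhds_oneVariable₂_eq_of_mem_centralWindow)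

namespace Summit.QuantumFields.YangMills.Theorems.FluctuationComparisonRegPrIntLWregChartCharge

/-! ## §6  β-letters: the iterated central bonds ABSTRACTED by their recursion (`β₀ = id`, `βₙ₊₁ = βₙ ∘ centralBond`) -/

section Letters

variable {P : Params} {G : Type*} [GaugeGroup G]
variable (β : ∀ (P : Params) (n : ℕ), PBond P n → PBond P 0)
  (hβ0 : ∀ (P : Params) (c : PBond P 0), β P 0 c = c)
  (hβs : ∀ (P : Params) (n : ℕ) (c : PBond P (n + 1)), β P (n + 1) c = β P n (centralBond c))
include hβ0 hβs

/-- `βₙ` is injective in the standing range `n ≤ m + K` (adapted from `Cruxes/…/wreg_chart.lean` §0 `iterCentralBond_injective`). [folklore] -/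
theorem β_injective : ∀ {n : ℕ}, n ≤ P.m + P.K → Injective (β P n)
  | 0, _ => fun a b h => by rwa [hβ0, hβ0] at h
  | n + 1, hn => fun c c' h => by
      rw [hβs, hβs] at h
      exact centralBond_injective (P := P) (j := n) (by omega) (β_injective (n := n) (by omega) h)

/-- ★ The `n`-fold block averaging is TRIANGULAR in the pivots `βₙ` (adapted from `wreg_chart.lean` §0 `isLocal_iter_blockAvg`). [folklore] -/
theorem isLocal_iter (ℰ : LoopAverage G) :
    ∀ {n : ℕ}, n ≤ P.m + P.K → IsLocal (β P n) (Averaging.iter (fun i => BlockAveraging.blockAvg (P := P) (j := i) ℰ) n)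
  | 0, _ => by
      intro U c g c' hc
      have hne : c' ≠ β P 0 c := by rw [hβ0]; exact hc
      simp [Averaging.iter, update_of_ne hne]
  | n + 1, hn => by
      intro U c g c' hc
      have IH := isLocal_iter ℰ (n := n) (by omega)
      rw [hβs]
      set W := Averaging.iter (fun i => BlockAveraging.blockAvg (P := P) (j := i) ℰ) n (update U (β P n (centralBond c)) g) with hW
      set W₀ := Averaging.iter (fun i => BlockAveraging.blockAvg (P := P) (j := i) ℰ) n U with hW₀
      have hWeq : W = update W₀ (centralBond c) (W (centralBond c)) := by
        funext b
        by_cases hb : b = centralBond c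
        · subst hb; simp
        · rw [update_of_ne hb]
          exact IH U (centralBond c) g b hb
      show BlockAveraging.avgFun ℰ W c' = BlockAveraging.avgFun ℰ W₀ c'
      rw [hWeq]
      exact isLocal_avgFun (by omega) ℰ W₀ c (W (centralBond c)) c' hc

/-- ★ CHAIN RECURSION (adapted from `wreg_chart.lean` §0b `chainMap_succ`): `Ū⁽ⁿ⁺¹⁾(U[βₙ₊₁ c ↦ g])(c)` is the one-bond (0.4) average at the environment `Ū⁽ⁿ⁾(U)` of
the level-`n` value at `centralBond c`. [folklore] -/
theorem iter_update_succ_apply (ℰ : LoopAverage G) {n : ℕ} (hn : n + 1 ≤ P.m + P.K) (U : GaugeField P 0 G) (c : PBond P (n + 1)) (g : G) :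
    Averaging.iter (fun i => BlockAveraging.blockAvg (P := P) (j := i) ℰ) (n + 1) (update U (β P (n + 1) c) g) c =
      avgFun ℰ (update (Averaging.iter (fun i => BlockAveraging.blockAvg (P := P) (j := i) ℰ) n U) (centralBond c)
        (Averaging.iter (fun i => BlockAveraging.blockAvg (P := P) (j := i) ℰ) n (update U (β P (n + 1) c) g) (centralBond c))) c := by
  have IH := isLocal_iter β hβ0 hβs ℰ (P := P) (n := n) (by omega)
  set W := Averaging.iter (fun i => BlockAveraging.blockAvg (P := P) (j := i) ℰ) n (update U (β P (n + 1) c) g) with hW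
  set W₀ := Averaging.iter (fun i => BlockAveraging.blockAvg (P := P) (j := i) ℰ) n U with hW₀
  have hWeq : W = update W₀ (centralBond c) (W (centralBond c)) := by
    funext b
    by_cases hb : b = centralBond c
    · subst hb; simp
    · rw [update_of_ne hb, hW, hβs]
      exact IH U (centralBond c) g b hb
  show BlockAveraging.avgFun ℰ W c = BlockAveraging.avgFun ℰ (update W₀ (centralBond c) (W (centralBond c))) c
  rw [← hWeq]

/-- All pivots at once: `Ū⁽ⁿ⁾(extend βₙ g z)(c) = Ū⁽ⁿ⁾(z[βₙ c ↦ g c])(c)` — each output reads only its own pivot (triangularity). [folklore] -/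
theorem iter_extend_apply (ℰ : LoopAverage G) {n : ℕ} (hn : n ≤ P.m + P.K) (z : GaugeField P 0 G) (g : PBond P n → G) (c : PBond P n) :
    Averaging.iter (fun i => BlockAveraging.blockAvg (P := P) (j := i) ℰ) n (Function.extend (β P n) g z) c =
      Averaging.iter (fun i => BlockAveraging.blockAvg (P := P) (j := i) ℰ) n (update z (β P n c) (g c)) c := by
  classical
  have hinj := β_injective β hβ0 hβs (P := P) (n := n) hn
  refine T4TriangularPushforward.apply_eq_of_agree (isLocal_iter β hβ0 hβs ℰ (P := P) (n := n) hn) c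
    ((Finset.univ.filter fun c' : PBond P n => c' ≠ c).image (β P n)) _ _ ?_ ?_
  · intro b hb
    by_cases hex : ∃ c', β P n c' = b
    · obtain ⟨c', rfl⟩ := hex
      have hc' : c' ≠ c := by
        rintro rfl
        exact hb (by rw [hinj.extend_apply, update_self])
      exact Finset.mem_image.2 ⟨c', Finset.mem_filter.2 ⟨Finset.mem_univ _, hc'⟩, rfl⟩
    · exfalso
      apply hb
      rw [Function.extend_apply' _ _ _ hex, update_of_ne]
      exact fun h => hex ⟨c, h.symm⟩
  · intro b hb
    obtain ⟨c', hc', rfl⟩ := Finset.mem_image.1 hb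
    exact ⟨c', (Finset.mem_filter.1 hc').2, rfl⟩

omit [GaugeGroup G] hβ0 hβs in
/-- The environment's own pivot values extend it to itself: `extend βₙ (U ∘ βₙ) U = U`. [folklore] -/
theorem extend_comp_self {n : ℕ} (U : GaugeField P 0 G) : Function.extend (β P n) (U ∘ β P n) U = U := by
  funext b
  by_cases hex : ∃ c, β P n c = b
  · rw [Function.extend_def, dif_pos hex]
    exact congrArg U (Classical.choose_spec hex)
  · exact Function.extend_apply' _ _ _ hex

end Letters

/-! ## §7  The chain: parametric openness of `(z, g) ↦ (z, Ū⁽ⁿ⁾(z[βₙ c ↦ g])(c))` at the sample's own pivot, for every `n ≤ m + K` (induction along `βₙ₊₁ = βₙ ∘ centralBond`) -/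

section Chain

variable {N : ℕ} [NeZero N] {P : Params}
variable (β : ∀ (P : Params) (n : ℕ), PBond P n → PBond P 0)
  (hβ0 : ∀ (P : Params) (c : PBond P 0), β P 0 c = c)
  (hβs : ∀ (P : Params) (n : ℕ) (c : PBond P (n + 1)), β P (n + 1) c = β P n (centralBond c))
include hβ0 hβs

omit hβ0 hβs in
/-- The `n`-fold printed average is continuous at every fine field whose intermediate averages `Ū⁽ᵏ⁾`, `k < n`, are in the loop `α`-guard, `α < δ_N`
(✓`continuousAt_avgFun_of_small` level by level). [cite: Balaban1987RG1, (0.4) p.253] -/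
theorem continuousAt_iter_of_loopSmall {α : ℝ} (hαδ : α < deltaSU (Fin N)) :
    ∀ {n : ℕ} (U₀ : GaugeField P 0 (SU N)),
      (∀ k, k < n → ∀ (c' : PBond P (k + 1)) (i : Idx P),
        dist1 (loopHol (Averaging.iter (fun i => BlockAveraging.blockAvg (P := P) (j := i) (expMeanLogSU (n := Fin N))) k U₀) c' i) ≤ α) →
      ContinuousAt (Averaging.iter (fun i => BlockAveraging.blockAvg (P := P) (j := i) (expMeanLogSU (n := Fin N))) n) U₀
  | 0, U₀, _ => continuousAt_id
  | n + 1, U₀, hsmall => by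
      have IH := continuousAt_iter_of_loopSmall hαδ (n := n) U₀ fun k hk => hsmall k (by omega)
      have hstep : ContinuousAt (avgFun (expMeanLogSU (n := Fin N)) : GaugeField P n (SU N) → GaugeField P (n + 1) (SU N))
          (Averaging.iter (fun i => BlockAveraging.blockAvg (P := P) (j := i) (expMeanLogSU (n := Fin N))) n U₀) :=
        continuousAt_avgFun_of_small _ fun c' i => (hsmall n (lt_add_one n) c' i).trans_lt hαδ
      exact hstep.comp IH

/-- ★★ **PARAMETRIC OPENNESS ALONG THE CHAIN**: for `n ≤ m + K`, a level-`n` bond `c`, and a fine field `U₀` whose intermediate averages `Ū⁽ᵏ⁾(U₀)`, `k < n`, have all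
loop variables `≤ α` (`α ≤ 1∕24`, `α < δ_N`, `157·α < L^{−(d−1)}`), the map `(z, g) ↦ (z, Ū⁽ⁿ⁾(z[βₙ c ↦ g])(c))` maps `𝓝 (U₀, U₀(βₙ c))` onto `𝓝 (U₀, Ū⁽ⁿ⁾(U₀)(c))`:
induction on `n` through the chain recursion `iter_update_succ_apply`, the one-bond joint openness ✓`map_nhds_oneVariable₂_eq_of_mem_centralWindow` at the environment
`Ū⁽ⁿ⁾(U₀)` (its own central-bond value is in its own window: ✓`self_mem_centralWindow_iff`), pulled back along the continuous `Ū⁽ⁿ⁾` (`map_nhds_param_pullback`).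
[cite: Balaban1985Averaging, Prop. 3 (124) p.36; Balaban1987RG1, (0.4) p.253 and (2.10) p.267] -/
theorem map_nhds_iterPivot_eq {α : ℝ} (hα24 : α ≤ 1 / 24) (hαδ : α < deltaSU (Fin N)) (hαL : 157 * α < ((P.L : ℝ) ^ (P.d - 1))⁻¹) :
    ∀ {n : ℕ}, n ≤ P.m + P.K → ∀ (c : PBond P n) (U₀ : GaugeField P 0 (SU N)),
      (∀ k, k < n → ∀ (c' : PBond P (k + 1)) (i : Idx P),
        dist1 (loopHol (Averaging.iter (fun i => BlockAveraging.blockAvg (P := P) (j := i) (expMeanLogSU (n := Fin N))) k U₀) c' i) ≤ α) →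
      map (fun q : GaugeField P 0 (SU N) × SU N =>
          (q.1, Averaging.iter (fun i => BlockAveraging.blockAvg (P := P) (j := i) (expMeanLogSU (n := Fin N))) n (update q.1 (β P n c) q.2) c))
        (𝓝 (U₀, U₀ (β P n c))) =
      𝓝 (U₀, Averaging.iter (fun i => BlockAveraging.blockAvg (P := P) (j := i) (expMeanLogSU (n := Fin N))) n U₀ c)
  | 0, _, c, U₀, _ => by
      have hfun : (fun q : GaugeField P 0 (SU N) × SU N =>
          (q.1, Averaging.iter (fun i => BlockAveraging.blockAvg (P := P) (j := i) (expMeanLogSU (n := Fin N))) 0 (update q.1 (β P 0 c) q.2) c)) = id := by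
        funext q
        simp [Averaging.iter, hβ0]
      rw [hfun, Filter.map_id, hβ0]
      rfl
  | n + 1, hn, c, U₀, hsmall => by
      -- the chain below `c`
      have hΩ := map_nhds_iterPivot_eq hα24 hαδ hαL (n := n) (by omega) (centralBond c) U₀ fun k hk => hsmall k (by omega)
      -- the one-bond step at the environment `Ū⁽ⁿ⁾(U₀)`, whose own central value lies in its own window
      set W₀ := Averaging.iter (fun i => BlockAveraging.blockAvg (P := P) (j := i) (expMeanLogSU (n := Fin N))) n U₀ with hW₀
      have hwin : ∀ i : Idx P, dist1 (fibreFamily W₀ c (pre W₀ c * W₀ (centralBond c) * post W₀ c) i) ≤ α :=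
        (self_mem_centralWindow_iff hn W₀ c α).2 (hsmall n (lt_add_one n) c)
      have hJO := map_nhds_oneVariable₂_eq_of_mem_centralWindow (N := N) hn c hα24 hαδ hαL hwin
      have hA : ContinuousAt (Averaging.iter (fun i => BlockAveraging.blockAvg (P := P) (j := i) (expMeanLogSU (n := Fin N))) n) U₀ :=
        continuousAt_iter_of_loopSmall (N := N) hαδ U₀ fun k hk => hsmall k (by omega)
      have hΞ := map_nhds_param_pullback (f := fun (W : GaugeField P n (SU N)) (h : SU N) => avgFun (expMeanLogSU (n := Fin N)) (update W (centralBond c) h) c)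
        (y₀ := W₀ (centralBond c)) hA hJO
      rw [update_eq_self] at hΞ
      -- compose
      have hcomp : (fun q : GaugeField P 0 (SU N) × SU N =>
          (q.1, Averaging.iter (fun i => BlockAveraging.blockAvg (P := P) (j := i) (expMeanLogSU (n := Fin N))) (n + 1) (update q.1 (β P (n + 1) c) q.2) c)) =
          (fun q : GaugeField P 0 (SU N) × SU N =>
            (q.1, avgFun (expMeanLogSU (n := Fin N))
              (update (Averaging.iter (fun i => BlockAveraging.blockAvg (P := P) (j := i) (expMeanLogSU (n := Fin N))) n q.1) (centralBond c) q.2) c)) ∘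
          (fun q : GaugeField P 0 (SU N) × SU N =>
            (q.1, Averaging.iter (fun i => BlockAveraging.blockAvg (P := P) (j := i) (expMeanLogSU (n := Fin N))) n
              (update q.1 (β P n (centralBond c)) q.2) (centralBond c))) := by
        funext q
        simp only [Function.comp_apply]
        rw [iter_update_succ_apply β hβ0 hβs _ hn, hβs]
      rw [hcomp, ← Filter.map_map, hβs, hΩ, hΞ]
      rfl

/-- ★★ **ALL PIVOTS AT ONCE**: `(z, g) ↦ (z, Ū⁽ⁿ⁾(extend βₙ g z))` maps `𝓝 (U₀, U₀ ∘ βₙ)` onto `𝓝 (U₀, Ū⁽ⁿ⁾ U₀)` under the same hypotheses (each output `c` reads only its own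
pivot, `iter_extend_apply`; finite product `map_nhds_param_pi`). [cite: Balaban1987RG1, (0.4) p.253 and (2.10) p.267] -/
theorem map_nhds_iterExtend_eq {α : ℝ} (hα24 : α ≤ 1 / 24) (hαδ : α < deltaSU (Fin N)) (hαL : 157 * α < ((P.L : ℝ) ^ (P.d - 1))⁻¹)
    {n : ℕ} (hn : n ≤ P.m + P.K) (U₀ : GaugeField P 0 (SU N))
    (hsmall : ∀ k, k < n → ∀ (c' : PBond P (k + 1)) (i : Idx P),
      dist1 (loopHol (Averaging.iter (fun i => BlockAveraging.blockAvg (P := P) (j := i) (expMeanLogSU (n := Fin N))) k U₀) c' i) ≤ α) :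
    map (fun q : GaugeField P 0 (SU N) × (PBond P n → SU N) =>
        (q.1, Averaging.iter (fun i => BlockAveraging.blockAvg (P := P) (j := i) (expMeanLogSU (n := Fin N))) n (Function.extend (β P n) q.2 q.1)))
      (𝓝 (U₀, U₀ ∘ β P n)) =
    𝓝 (U₀, Averaging.iter (fun i => BlockAveraging.blockAvg (P := P) (j := i) (expMeanLogSU (n := Fin N))) n U₀) := by
  have hfun : (fun q : GaugeField P 0 (SU N) × (PBond P n → SU N) =>
        (q.1, Averaging.iter (fun i => BlockAveraging.blockAvg (P := P) (j := i) (expMeanLogSU (n := Fin N))) n (Function.extend (β P n) q.2 q.1))) =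
      (fun q : GaugeField P 0 (SU N) × (PBond P n → SU N) =>
        (q.1, fun c => Averaging.iter (fun i => BlockAveraging.blockAvg (P := P) (j := i) (expMeanLogSU (n := Fin N))) n (update q.1 (β P n c) (q.2 c)) c)) := by
    funext q
    refine Prod.ext rfl (funext fun c => ?_)
    exact iter_extend_apply β hβ0 hβs _ hn q.1 q.2 c
  rw [hfun]
  have hpi := map_nhds_param_pi (X := GaugeField P 0 (SU N)) (x₀ := U₀) (y₀ := U₀ ∘ β P n)
    (f := fun c (z : GaugeField P 0 (SU N)) (g : SU N) =>
      Averaging.iter (fun i => BlockAveraging.blockAvg (P := P) (j := i) (expMeanLogSU (n := Fin N))) n (update z (β P n c) g) c)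
    (fun c => by
      simp only [Function.comp_apply, update_eq_self]
      exact map_nhds_iterPivot_eq β hβ0 hβs hα24 hαδ hαL hn c U₀ hsmall)
  simp only [Function.comp_apply, update_eq_self] at hpi
  exact hpi

end Chain

/-! ## §8  CHARGE on the three-torus (`SU(2)`, `ℰp = expMeanLogSU (Fin 2)`) — the Theorems-side twin of `wreg_chart.lean`'s `ChartCharge` with `iterCentralBond` abstracted by its recursion -/

section Charge

open Literature.MathematicalPhysics.QuantumFieldTheory.Balaban1983to89.B12ContinuousTransportInvariance (isOpenPosMeasure_fieldMeasure_SU)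

/-- ★★ **CHARGE `ChartCharge` (LINE g18-2 `Cruxes/FluctuationComparisonRegPrIntL/Lines/wreg_chart.lean`, v15 :2327 ∕ v16, stub `stub_chartCharge`) WITH THE CRUXES-LOCAL RECURSION
`iterCentralBond` ABSTRACTED** (`β P 0 = id`, `β P (n+1) = β P n ∘ centralBond`; door-fit `stub_chartCharge := chartCharge_holds (fun P n => iterCentralBond n) (fun _ _ => rfl)
(fun _ _ _ => rfl)`, LINE OWNER ideator ym-r3-idea-1 g18 14:51:43Z): if the leaf `{Ū⁽ᴷ⁻ᴶ⁾ = W}` of the iterated printed average meets the INTERIOR of the UV-small-history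
event `histGood F ℰp θ K J`, then the environments `z` whose off-pivot coordinates extend by some pivot values `g` to a point of that leaf inside `histGood` have POSITIVE
product-Haar measure.  PROOF (parametric solvability, no degree theory, no chosen chart): at the interior point `U₀` every intermediate average is `θ`-small, hence its loop
variables are `≤ (((d+2)L)²∕4)·θ ≤ α` (✓`dist1_loopHol_le`); by §7 the map `(z, g) ↦ (z, Ū⁽ᴷ⁻ᴶ⁾(extend β g z))` maps `𝓝 (U₀, U₀ ∘ β)` onto `𝓝 (U₀, W)`; the preimage of
`interior histGood` under the continuous `(z, g) ↦ extend β g z` is a neighbourhood of `(U₀, U₀ ∘ β)` (`extend β (U₀ ∘ β) U₀ = U₀`), so its image is a neighbourhood of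
`(U₀, W)`, whose slice at `W` is a neighbourhood of `U₀` contained in the target set; product Haar on `SU(2)`-fields charges neighbourhoods
(✓`isOpenPosMeasure_fieldMeasure_SU`).  Nothing of WREG ∕ S2β ∕ the crux stmt-QuantumFields-20520 is proved here; no summit statement is proved.
[cite: Balaban1987RG1, (0.4) p.253 and (2.10) p.267; Balaban1985Averaging, (10) p.19 and Prop. 3 (124) p.36; Balaban1985UV3, (7) p.257] -/
theorem chartCharge_holds (β : ∀ (P : Params) (n : ℕ), PBond P n → PBond P 0)
    (hβ0 : ∀ (P : Params) (c : PBond P 0), β P 0 c = c)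
    (hβs : ∀ (P : Params) (n : ℕ) (c : PBond P (n + 1)), β P (n + 1) c = β P n (centralBond c)) :
  ∀ (F : T3Family) (K J : ℕ) (θ : ℕ → ℝ) (α : ℝ), (∀ i, 0 ≤ θ i) → 0 < α → α ≤ 1 / 24 → 64 * α ≤ deltaSU (Fin 2) →
    157 * α < (((F.P K).L : ℝ) ^ ((F.P K).d - 1))⁻¹ →
    (∀ j (c : PBond (F.P K) (j + 1)), (offCard c : ℝ) / (Fintype.card (Idx (F.P K)) : ℝ) + 150 * α < 1) →
    (∀ i, (((((F.P K).d + 2) * (F.P K).L : ℕ) : ℝ) ^ 2 / 4) * θ i ≤ α) →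
    ∀ W : GaugeField (F.P K) (K - J) (Matrix.specialUnitaryGroup (Fin 2) ℂ),
      (∃ U₀ ∈ interior (histGood F ℰp θ K J),
          Averaging.iter (fun i => BlockAveraging.blockAvg (P := F.P K) (j := i) ℰp) (K - J) U₀ = W) →
      0 < fieldMeasure (F.P K) 0 (Matrix.specialUnitaryGroup (Fin 2) ℂ)
        {z | ∃ g : PBond (F.P K) (K - J) → Matrix.specialUnitaryGroup (Fin 2) ℂ,
          Function.extend (β (F.P K) (K - J)) g z ∈ histGood F ℰp θ K J ∧
          Averaging.iter (fun i => BlockAveraging.blockAvg (P := F.P K) (j := i) ℰp) (K - J)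
            (Function.extend (β (F.P K) (K - J)) g z) = W} := by
  intro F K J θ α hθ0 hα0 hα24 hα64 hαL _hgap hθα W hex
  obtain ⟨U₀, hU₀, hW⟩ := hex
  have hαδ : α < deltaSU (Fin 2) := by linarith
  have hKeq : (F.P K).K = K := rfl
  have hn : K - J ≤ (F.P K).m + (F.P K).K := by rw [hKeq]; omega
  have hU₀good : U₀ ∈ histGood F ℰp θ K J := interior_subset hU₀
  -- every intermediate average of `U₀` is in the loop `α`-guard
  have hsmall : ∀ k, k < K - J → ∀ (c' : PBond (F.P K) (k + 1)) (i : Idx (F.P K)),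
      dist1 (loopHol (Averaging.iter (fun i => BlockAveraging.blockAvg (P := F.P K) (j := i) ℰp) k U₀) c' i) ≤ α := by
    intro k hk c' i
    have hps : PlaqSmall (θ (K - k)) (Averaging.iter (fun i => BlockAveraging.blockAvg (P := F.P K) (j := i) ℰp) k U₀) := hU₀good k (by omega)
    exact (dist1_loopHol_le (hθ0 _) hps c' i).trans (hθα _)
  -- §7: the joint map `(z, g) ↦ (z, Ū⁽ᴷ⁻ᴶ⁾(extend β g z))` is open at `(U₀, U₀ ∘ β)`
  have hmap := map_nhds_iterExtend_eq (N := 2) β hβ0 hβs hα24 hαδ hαL hn U₀ hsmall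
  -- the coordinate shuffle `(z, g) ↦ extend β g z` is continuous and sends `(U₀, U₀ ∘ β)` to `U₀ ∈ interior histGood`
  have hcont : Continuous fun q : GaugeField (F.P K) 0 (Matrix.specialUnitaryGroup (Fin 2) ℂ) × (PBond (F.P K) (K - J) → Matrix.specialUnitaryGroup (Fin 2) ℂ) =>
      Function.extend (β (F.P K) (K - J)) q.2 q.1 := by
    refine continuous_pi fun b => ?_
    by_cases hb : ∃ c, β (F.P K) (K - J) c = b
    · have hfun : (fun q : GaugeField (F.P K) 0 (Matrix.specialUnitaryGroup (Fin 2) ℂ) × (PBond (F.P K) (K - J) → Matrix.specialUnitaryGroup (Fin 2) ℂ) =>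
          Function.extend (β (F.P K) (K - J)) q.2 q.1 b) = fun q => q.2 (Classical.choose hb) := by
        funext q; rw [Function.extend_def, dif_pos hb]
      rw [hfun]; exact (continuous_apply _).comp continuous_snd
    · have hfun : (fun q : GaugeField (F.P K) 0 (Matrix.specialUnitaryGroup (Fin 2) ℂ) × (PBond (F.P K) (K - J) → Matrix.specialUnitaryGroup (Fin 2) ℂ) =>
          Function.extend (β (F.P K) (K - J)) q.2 q.1 b) = fun q => q.1 b := by
        funext q; rw [Function.extend_apply' _ _ _ hb]
      rw [hfun]; exact (continuous_apply _).comp continuous_fst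
  have hpre : (fun q : GaugeField (F.P K) 0 (Matrix.specialUnitaryGroup (Fin 2) ℂ) × (PBond (F.P K) (K - J) → Matrix.specialUnitaryGroup (Fin 2) ℂ) =>
      Function.extend (β (F.P K) (K - J)) q.2 q.1) ⁻¹' interior (histGood F ℰp θ K J) ∈ 𝓝 (U₀, U₀ ∘ β (F.P K) (K - J)) := by
    refine hcont.continuousAt.preimage_mem_nhds (isOpen_interior.mem_nhds ?_)
    show Function.extend (β (F.P K) (K - J)) (U₀ ∘ β (F.P K) (K - J)) U₀ ∈ interior (histGood F ℰp θ K J)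
    rw [extend_comp_self β]; exact hU₀
  -- its image is a neighbourhood of `(U₀, W)`
  have himg := image_mem_map (m := fun q : GaugeField (F.P K) 0 (Matrix.specialUnitaryGroup (Fin 2) ℂ) ×
      (PBond (F.P K) (K - J) → Matrix.specialUnitaryGroup (Fin 2) ℂ) =>
        (q.1, Averaging.iter (fun i => BlockAveraging.blockAvg (P := F.P K) (j := i) ℰp) (K - J) (Function.extend (β (F.P K) (K - J)) q.2 q.1))) hpre
  rw [hmap, hW] at himg
  -- slice at `W`
  have hslice : {z : GaugeField (F.P K) 0 (Matrix.specialUnitaryGroup (Fin 2) ℂ) | (z, W) ∈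
      (fun q : GaugeField (F.P K) 0 (Matrix.specialUnitaryGroup (Fin 2) ℂ) × (PBond (F.P K) (K - J) → Matrix.specialUnitaryGroup (Fin 2) ℂ) =>
        (q.1, Averaging.iter (fun i => BlockAveraging.blockAvg (P := F.P K) (j := i) ℰp) (K - J) (Function.extend (β (F.P K) (K - J)) q.2 q.1))) ''
      ((fun q => Function.extend (β (F.P K) (K - J)) q.2 q.1) ⁻¹' interior (histGood F ℰp θ K J))} ∈ 𝓝 U₀ :=
    (continuous_id.prodMk continuous_const).continuousAt.preimage_mem_nhds himg
  -- the slice lies in the target set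
  haveI := isOpenPosMeasure_fieldMeasure_SU (N := 2) (F.P K) 0
  refine (Measure.measure_pos_of_mem_nhds (fieldMeasure (F.P K) 0 (Matrix.specialUnitaryGroup (Fin 2) ℂ)) hslice).trans_le (measure_mono ?_)
  rintro z ⟨⟨z', g⟩, hq, hzq⟩
  simp only [Prod.mk.injEq] at hzq
  obtain ⟨rfl, hiter⟩ := hzq
  exact ⟨g, interior_subset hq, hiter⟩

end Charge

end Summit.QuantumFields.YangMills.Theorems.FluctuationComparisonRegPrIntLWregChartCharge

end
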